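import Literature.Computability.AlgebraicComplexity.TableauEvalContentDP
import HarnessLib

/-!
# The content-state column-major programme computes `evalC` (proofs for `TableauEvalContentDP.lean`)

Lean checker of the tableau highest-weight-vector evaluators (cell `val-lit`, Dörfler–Ikenmeyer–Panova's
toy model `Ch_4^7`; honest framing of that cell: kernel replay of a published computer verification at a
KNOWN separation; no claim about VP ≠ VNP or P ≠ NP is made here or there).

`TableauEvalContentDP.lean` defines `evalM tab cap Nw`, the column-by-column dynamic programme over
per-label CONTENT vectors of [DorflerIkenmeyerPanova2020, §5 (arXiv p. 13)], run against a content table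
`tab` and pruned by a bound `cap`. This file proves

* §1 `evalColsK` — the column recursion of `evalCols` (`PlethysmTableauEvaluation.lean`) transcribed to
  content states against a value function `S` on contents, and **`evalCols_eq_evalColsK`**: for
  accumulators whose words end up with length `m` and letters `< V`, `evalCols P cs acc` equals
  `evalColsK S cs (acc.map (counts V))` as soon as `symEntry P w = S (counts V w)` on such words (the
  polarisation identity, supplied by `lookupC_counts_eq_symEntry`); bookkeeping `counts ∘ pushAll =
  bumpAll ∘ counts`;
* §2 pruning: a state one of whose labels is no longer dominated by `cap` evaluates to `0` when every
  content with a nonzero value is dominated by `cap` (`evalColsK_eq_zero_of_not_domLE`), and the checked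
  bump `bumpAllChk` returns either `some (bumpAll …)` or `none` at such a state (`bumpAllChk_spec`);
* §3 the programme preserves the weighted sum `∑ value · evalColsK S cs state` of a layer: `mergeM`,
  `mergePairs`, `mergeAll`, `shiftOpt`, `stepM`, `layersM`;
* §4 **`evalM_eq_evalC`**: for a point all of whose terms have `m` forms, a network passing its structural
  check and a content table passing `checkTable` whose nonzero keys are dominated by `cap`,
  `evalM tab cap Nw = evalC P Nw` — NO column-strictness is needed;
* §5 the certificate theorem **`coordRingMultiplicity_chowSet_pos_of_tableCertificateM`** (one network, one
  integer Chow point with its checked table, a nonzero value of `evalM` ⇒ `0 < mult_{λ^*} K[Ch_N^m]`), the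
  `evalM` twin of `coordRingMultiplicity_chowSet_pos_of_tableCertificate` on the tree's
  `le_coordRingMultiplicity_of_certificate`.

Elementary [folklore] list bookkeeping around the cited formula; no new statement about representations.

## References
* [DorflerIkenmeyerPanova2020] J. Dörfler, C. Ikenmeyer, G. Panova, *On geometric complexity theory:
  multiplicity obstructions are stronger than occurrence obstructions*, SIAM J. Appl. Algebra Geom. 4
  (2020) = arXiv:1901.04576, §5 (eq. (5.6) and the dynamic programme over content vectors, arXiv p. 13),
  Prop. 5.1 (arXiv p. 12).
-/

namespace Literature.Computability.AlgebraicComplexity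

namespace TableauEval

open MvPolynomial

/-! ## §1 The content recursion and `evalCols` -/

section Spec

variable {R : Type*} [CommRing R]

/-- The column recursion of `evalCols` on CONTENT states against a value function `S` on contents: a
signed sum over the bijections of the remaining columns, at the end the product over labels of `S`.
[folklore] -/
def evalColsK (S : List ℕ → R) : List Column → List (List ℕ) → R
  | [], st => (st.map S).prod
  | c :: cs, st =>
    ((permsSign c.vars).map fun q => sgn q.1 * evalColsK S cs (bumpAll st c.labels q.2)).sum

omit [CommRing R] in
/-- `incAt` keeps the length. [folklore] -/
private theorem length_incAt : ∀ (l : List ℕ) (i : ℕ), (incAt l i).length = l.length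
  | [], _ => rfl
  | _ :: _, 0 => rfl
  | _ :: l, i + 1 => by simp [incAt, length_incAt l i]

omit [CommRing R] in
/-- Entries of `incAt`: entry `i` goes up by one, the others stay. [folklore] -/
private theorem getD_incAt : ∀ (l : List ℕ) (i k : ℕ),
    (incAt l i).getD k 0 = l.getD k 0 + if k = i ∧ i < l.length then 1 else 0
  | [], i, k => by simp [incAt]
  | a :: l, 0, 0 => by simp [incAt]
  | a :: l, 0, k + 1 => by simp [incAt]
  | a :: l, i + 1, 0 => by simp [incAt]
  | a :: l, i + 1, k + 1 => by
    simp only [incAt, List.getD_cons_succ, getD_incAt l i k, List.length_cons]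
    by_cases h : k = i ∧ i < l.length
    · rw [if_pos h, if_pos ⟨by omega, by omega⟩]
    · rw [if_neg h, if_neg (fun h' => h ⟨by omega, by omega⟩)]

omit [CommRing R] in
/-- `bumpAt` keeps the number of labels. [folklore] -/
private theorem length_bumpAt : ∀ (st : List (List ℕ)) (u v : ℕ), (bumpAt st u v).length = st.length
  | [], _, _ => rfl
  | _ :: _, 0, _ => rfl
  | _ :: st, u + 1, v => by simp [bumpAt, length_bumpAt st u v]

omit [CommRing R] in
/-- `bumpAt` on the labels: label `u` is bumped, the others stay. [folklore] -/
private theorem getD_bumpAt : ∀ (st : List (List ℕ)) (u v u' : ℕ),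
    (bumpAt st u v).getD u' [] = if u' = u ∧ u < st.length then incAt (st.getD u' []) v else st.getD u' []
  | [], u, v, u' => by simp [bumpAt]
  | c :: st, 0, v, 0 => by simp [bumpAt]
  | c :: st, 0, v, u' + 1 => by simp [bumpAt]
  | c :: st, u + 1, v, 0 => by simp [bumpAt]
  | c :: st, u + 1, v, u' + 1 => by
    simp only [bumpAt, List.getD_cons_succ, getD_bumpAt st u v u', List.length_cons]
    by_cases h : u' = u ∧ u < st.length
    · rw [if_pos h, if_pos ⟨by omega, by omega⟩]
    · rw [if_neg h, if_neg (fun h' => h ⟨by omega, by omega⟩)]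

omit [CommRing R] in
/-- `bumpAll` keeps the number of labels. [folklore] -/
private theorem length_bumpAll : ∀ (st : List (List ℕ)) (us vs : List ℕ),
    (bumpAll st us vs).length = st.length
  | st, [], vs => by cases vs <;> rfl
  | st, _ :: _, [] => rfl
  | st, u :: us, v :: vs => by rw [bumpAll, length_bumpAll, length_bumpAt]

omit [CommRing R] in
/-- The count vector of a longer word. [folklore] -/
private theorem counts_cons (V i : ℕ) (w : List ℕ) : counts V (i :: w) = incAt (counts V w) i := by
  apply List.ext_getElem
  · simp [counts, length_incAt]
  · intro k h1 h2
    have hk : k < V := by simpa [counts] using h1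
    have e1 : (counts V (i :: w))[k] = (i :: w).count k := by simp [counts, List.getElem_range]
    have e2 : (incAt (counts V w) i)[k] = (incAt (counts V w) i).getD k 0 :=
      (List.getD_eq_getElem _ _ h2).symm
    rw [e1, e2, getD_incAt, List.getD_eq_getElem _ _ (by simpa [counts] using hk)]
    simp only [counts, List.getElem_map, List.getElem_range, List.length_map, List.length_range,
      List.count_cons]
    by_cases hki : k = i
    · subst hki; simp [hk]
    · simp [hki, beq_eq_false_iff_ne.mpr (Ne.symm hki)]

omit [CommRing R] in
/-- `counts ∘ consAt = bumpAt ∘ counts`. [folklore] -/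
private theorem map_counts_consAt (V : ℕ) : ∀ (acc : List (List ℕ)) (u i : ℕ),
    (consAt acc u i).map (counts V) = bumpAt (acc.map (counts V)) u i
  | [], _, _ => rfl
  | w :: acc, 0, i => by simp [consAt, bumpAt, counts_cons]
  | w :: acc, u + 1, i => by simp [consAt, bumpAt, map_counts_consAt V acc u i]

omit [CommRing R] in
/-- `counts ∘ pushAll = bumpAll ∘ counts`. [folklore] -/
private theorem map_counts_pushAll (V : ℕ) : ∀ (acc : List (List ℕ)) (us is : List ℕ),
    (pushAll acc us is).map (counts V) = bumpAll (acc.map (counts V)) us is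
  | acc, [], is => by cases is <;> rfl
  | acc, _ :: _, [] => rfl
  | acc, u :: us, i :: is => by
    rw [pushAll, bumpAll, map_counts_pushAll V _ us is, map_counts_consAt]

omit [CommRing R] in
/-- Lengths of the accumulated words under `consAt`. [folklore] -/
private theorem length_getD_consAt : ∀ (acc : List (List ℕ)) (u i u' : ℕ), u' < acc.length →
    ((consAt acc u i).getD u' []).length = (acc.getD u' []).length + if u' = u then 1 else 0
  | [], _, _, _, h => absurd h (Nat.not_lt_zero _)
  | l :: ls, 0, i, 0, _ => by simp [consAt]
  | l :: ls, 0, i, u' + 1, _ => by simp [consAt]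
  | l :: ls, u + 1, i, 0, _ => by simp [consAt]
  | l :: ls, u + 1, i, u' + 1, h => by
    rw [consAt, List.getD_cons_succ, List.getD_cons_succ, length_getD_consAt ls u i u' (by simpa using h)]
    simp

omit [CommRing R] in
/-- Lengths of the accumulated words under `pushAll`: the word of label `u` grows by the number of boxes
labelled `u`. [folklore] -/
private theorem length_getD_pushAll : ∀ (acc : List (List ℕ)) (us is : List ℕ), us.length = is.length →
    ∀ u, u < acc.length →
      ((pushAll acc us is).getD u []).length = (acc.getD u []).length + countNat u us
  | acc, [], [], _, u, _ => by simp [pushAll, countNat]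
  | acc, [], _ :: _, h, _, _ => absurd h (by simp)
  | acc, _ :: _, [], h, _, _ => absurd h (by simp)
  | acc, u' :: us, i :: is, h, u, hu => by
    rw [pushAll, length_getD_pushAll (consAt acc u' i) us is (by simpa using h) u
      (by rw [length_consAt]; exact hu), length_getD_consAt acc u' i u hu]
    simp only [countNat, List.filter_cons]
    by_cases huu : u' = u
    · subst huu; simp; omega
    · simp [huu, Ne.symm huu]

omit [CommRing R] in
/-- Letters of the accumulated words under `consAt`. [folklore] -/
private theorem mem_consAt : ∀ (acc : List (List ℕ)) (u i : ℕ) (w : List ℕ), w ∈ consAt acc u i →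
    ∀ v ∈ w, v = i ∨ ∃ w' ∈ acc, v ∈ w'
  | [], _, _, w, h, _, _ => by simp [consAt] at h
  | l :: ls, 0, i, w, h, v, hv => by
    simp only [consAt, List.mem_cons] at h
    rcases h with rfl | h
    · simp only [List.mem_cons] at hv
      rcases hv with rfl | hv
      · exact Or.inl rfl
      · exact Or.inr ⟨l, List.mem_cons_self, hv⟩
    · exact Or.inr ⟨w, List.mem_cons_of_mem _ h, hv⟩
  | l :: ls, u + 1, i, w, h, v, hv => by
    simp only [consAt, List.mem_cons] at h
    rcases h with rfl | h
    · exact Or.inr ⟨w, List.mem_cons_self, hv⟩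
    · rcases mem_consAt ls u i w h v hv with h1 | ⟨w', hw', h1⟩
      · exact Or.inl h1
      · exact Or.inr ⟨w', List.mem_cons_of_mem _ hw', h1⟩

omit [CommRing R] in
/-- Letters of the accumulated words under `pushAll`. [folklore] -/
private theorem mem_pushAll : ∀ (acc : List (List ℕ)) (us is : List ℕ) (w : List ℕ), w ∈ pushAll acc us is →
    ∀ v ∈ w, v ∈ is ∨ ∃ w' ∈ acc, v ∈ w'
  | acc, [], is, w, h, v, hv => by
    cases is <;> exact Or.inr ⟨w, h, hv⟩
  | acc, _ :: _, [], w, h, v, hv => Or.inr ⟨w, h, hv⟩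
  | acc, u :: us, i :: is, w, h, v, hv => by
    rw [pushAll] at h
    rcases mem_pushAll _ us is w h v hv with h1 | ⟨w', hw', h1⟩
    · exact Or.inl (List.mem_cons_of_mem _ h1)
    · rcases mem_consAt acc u i w' hw' v h1 with h2 | h2
      · exact Or.inl (h2 ▸ List.mem_cons_self)
      · exact Or.inr h2

omit [CommRing R] in
/-- Every insertion of `a` into `l` consists of `a` and the elements of `l`. [folklore] -/
private theorem mem_of_mem_insertionsM {α : Type*} (a : α) : ∀ (l : List α) (r : Bool × List α),
    r ∈ insertions a l → ∀ j ∈ r.2, j = a ∨ j ∈ l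
  | [], r, h, j, hj => by
    simp [insertions] at h
    subst h
    simp at hj
    exact Or.inl hj
  | b :: l, r, h, j, hj => by
    simp only [insertions, List.mem_cons, List.mem_map] at h
    rcases h with rfl | ⟨r', hr', rfl⟩
    · simp only [List.mem_cons] at hj
      rcases hj with rfl | rfl | hj
      · exact Or.inl rfl
      · exact Or.inr List.mem_cons_self
      · exact Or.inr (List.mem_cons_of_mem _ hj)
    · simp only [List.mem_cons] at hj
      rcases hj with rfl | hj
      · exact Or.inr List.mem_cons_self
      · rcases mem_of_mem_insertionsM a l r' hr' j hj with h1 | h1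
        · exact Or.inl h1
        · exact Or.inr (List.mem_cons_of_mem _ h1)

omit [CommRing R] in
/-- Every signed permutation of `l` consists of elements of `l`. [folklore] -/
private theorem mem_of_mem_permsSignM {α : Type*} : ∀ (l : List α) (q : Bool × List α),
    q ∈ permsSign l → ∀ j ∈ q.2, j ∈ l
  | [], q, h, j, hj => by simp [permsSign] at h; subst h; simp at hj
  | a :: l, q, h, j, hj => by
    rw [permsSign, List.mem_flatMap] at h
    obtain ⟨q', hq', h⟩ := h
    rw [List.mem_map] at h
    obtain ⟨r, hr, rfl⟩ := h
    rcases mem_of_mem_insertionsM a q'.2 r hr j hj with h1 | h1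
    · exact h1 ▸ List.mem_cons_self
    · exact List.mem_cons_of_mem _ (mem_of_mem_permsSignM l q' hq' j h1)

omit [CommRing R] in
/-- Insertions lengthen by one. [folklore] -/
private theorem length_of_mem_insertionsM {α : Type*} (a : α) : ∀ (l : List α) (q : Bool × List α),
    q ∈ insertions a l → q.2.length = l.length + 1
  | [], q, h => by simp [insertions] at h; simp [h]
  | b :: l, q, h => by
    simp only [insertions, List.mem_cons, List.mem_map] at h
    rcases h with rfl | ⟨q', hq', rfl⟩
    · simp
    · simp [length_of_mem_insertionsM a l q' hq']

omit [CommRing R] in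
/-- Every signed permutation of `l` has the length of `l`. [folklore] -/
private theorem length_of_mem_permsSignM {α : Type*} : ∀ (l : List α) (q : Bool × List α),
    q ∈ permsSign l → q.2.length = l.length
  | [], q, h => by simp [permsSign] at h; simp [h]
  | a :: l, q, h => by
    rw [permsSign, List.mem_flatMap] at h
    obtain ⟨q', hq', h⟩ := h
    rw [List.mem_map] at h
    obtain ⟨r, hr, rfl⟩ := h
    simp only [List.length_cons]
    rw [length_of_mem_insertionsM a q'.2 r hr, length_of_mem_permsSignM l q' hq']

omit [CommRing R] in
/-- `countNat` over a concatenation. [folklore] -/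
private theorem countNat_append (u : ℕ) (l₁ l₂ : List ℕ) :
    countNat u (l₁ ++ l₂) = countNat u l₁ + countNat u l₂ := by
  simp [countNat, List.filter_append]

/-- **`evalCols` is the content recursion.** For an accumulator of `d` words with letters `< V` whose
word of label `u` is completed to length `m` by the boxes labelled `u` of the remaining columns (all with
as many alternator variables, `< V`, as boxes), and a value function `S` agreeing with the
symmetric-tensor entry on words of length `m` with letters `< V` through their content,
`evalCols P cs acc = evalColsK S cs (acc.map (counts V))`.
[cite: DorflerIkenmeyerPanova2020, §5 ("only depends on the content vectors", arXiv p. 13)] -/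
theorem evalCols_eq_evalColsK (P : Point R) (V m d : ℕ) (S : List ℕ → R)
    (hS : ∀ w : List ℕ, w.length = m → (∀ v ∈ w, v < V) → symEntry P w = S (counts V w)) :
    ∀ (cs : List Column) (acc : List (List ℕ)),
      acc.length = d → (∀ w ∈ acc, ∀ v ∈ w, v < V) →
      (∀ u, u < d → (acc.getD u []).length + countNat u (cs.flatMap Column.labels) = m) →
      (∀ c ∈ cs, c.vars.length = c.labels.length) → (∀ c ∈ cs, ∀ v ∈ c.vars, v < V) →
      evalCols P cs acc = evalColsK S cs (acc.map (counts V))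
  | [], acc, hd, hlt, hlenw, _, _ => by
    rw [evalCols, evalColsK, List.map_map]
    congr 1
    refine List.map_congr_left fun w hw => ?_
    obtain ⟨u, hu, rfl⟩ := List.getElem_of_mem hw
    have hwl : (acc.getD u []).length = m := by
      have := hlenw u (hd ▸ hu); simpa [countNat] using this
    rw [List.getD_eq_getElem _ _ hu] at hwl
    exact hS _ hwl (hlt _ hw)
  | c :: cs, acc, hd, hlt, hlenw, hlen, hvar => by
    rw [evalCols, evalColsK]
    congr 1
    refine List.map_congr_left fun q hq => ?_
    have hql : q.2.length = c.labels.length :=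
      (length_of_mem_permsSignM c.vars q hq).trans (hlen c List.mem_cons_self)
    have hqv : ∀ j ∈ q.2, j < V := fun j hj =>
      hvar c List.mem_cons_self j (mem_of_mem_permsSignM c.vars q hq j hj)
    rw [← map_counts_pushAll]
    congr 1
    refine evalCols_eq_evalColsK P V m d S hS cs (pushAll acc c.labels q.2) ?_ ?_ ?_
      (fun c' hc' => hlen c' (List.mem_cons_of_mem _ hc'))
      (fun c' hc' => hvar c' (List.mem_cons_of_mem _ hc'))
    · rw [length_pushAll, hd]
    · intro w hw v hv
      rcases mem_pushAll acc c.labels q.2 w hw v hv with h1 | ⟨w', hw', h1⟩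
      · exact hqv v h1
      · exact hlt w' hw' v h1
    · intro u hu
      rw [length_getD_pushAll acc c.labels q.2 hql.symm u (hd ▸ hu)]
      have := hlenw u hu
      rw [List.flatMap_cons, countNat_append] at this
      omega

end Spec

/-! ## §2 Pruning by the bound `cap` -/

section Prune

variable {R : Type*} [CommRing R]

omit [CommRing R] in
/-- A count vector with an entry above its bound is not dominated. [folklore] -/
private theorem domLE_eq_false_of_lt : ∀ (c cap : List ℕ) (k : ℕ), k < c.length → cap.getD k 0 < c.getD k 0 →
    domLE c cap = false
  | [], _, _, h, _ => absurd h (Nat.not_lt_zero _)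
  | a :: l, [], _, _, _ => rfl
  | a :: l, b :: m, 0, _, h => by
    have h' : b < a := h
    simp [domLE, Nat.ble_eq, Nat.not_le.mpr h']
  | a :: l, b :: m, k + 1, hk, h => by
    simp only [List.getD_cons_succ, List.length_cons] at h hk
    simp [domLE, domLE_eq_false_of_lt l m k (by omega) h]

omit [CommRing R] in
/-- Domination is lost for good: a pointwise larger vector of the same length is not dominated either.
[folklore] -/
private theorem domLE_eq_false_mono : ∀ (c c' cap : List ℕ), c'.length = c.length →
    (∀ k, c.getD k 0 ≤ c'.getD k 0) → domLE c cap = false → domLE c' cap = false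
  | [], c', cap, _, _, h => by simp [domLE] at h
  | a :: l, [], cap, hl, _, _ => by simp at hl
  | a :: l, a' :: l', [], _, _, _ => rfl
  | a :: l, a' :: l', b :: m, hl, hle, h => by
    simp only [domLE, Bool.and_eq_false_iff] at h ⊢
    rcases h with h | h
    · left
      have h0 : a ≤ a' := hle 0
      have h' : ¬ a ≤ b := fun hab => by
        have : Nat.ble a b = true := Nat.ble_eq.mpr hab
        rw [this] at h; exact Bool.noConfusion h
      apply Bool.eq_false_iff.mpr
      intro h2
      have := Nat.ble_eq.mp h2
      omega
    · right
      exact domLE_eq_false_mono l l' m (by simpa using hl)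
        (fun k => by simpa using hle (k + 1)) h

omit [CommRing R] in
/-- `incAt` is pointwise increasing. [folklore] -/
private theorem getD_le_getD_incAt (l : List ℕ) (i k : ℕ) : l.getD k 0 ≤ (incAt l i).getD k 0 := by
  rw [getD_incAt]; omega

omit [CommRing R] in
/-- `bumpAll` is pointwise increasing on every label and keeps the lengths of the count vectors.
[folklore] -/
private theorem getD_bumpAll_dominates : ∀ (st : List (List ℕ)) (us vs : List ℕ) (u : ℕ),
    ((bumpAll st us vs).getD u []).length = (st.getD u []).length ∧
      ∀ k, (st.getD u []).getD k 0 ≤ ((bumpAll st us vs).getD u []).getD k 0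
  | st, [], vs, u => by cases vs <;> exact ⟨rfl, fun _ => le_rfl⟩
  | st, _ :: _, [], u => ⟨rfl, fun _ => le_rfl⟩
  | st, u' :: us, v :: vs, u => by
    rw [bumpAll]
    obtain ⟨h1, h2⟩ := getD_bumpAll_dominates (bumpAt st u' v) us vs u
    have h3 : ((bumpAt st u' v).getD u []).length = (st.getD u []).length ∧
        ∀ k, (st.getD u []).getD k 0 ≤ ((bumpAt st u' v).getD u []).getD k 0 := by
      rw [getD_bumpAt]
      split_ifs
      · exact ⟨length_incAt _ _, fun k => getD_le_getD_incAt _ _ _⟩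
      · exact ⟨rfl, fun _ => le_rfl⟩
    exact ⟨h1.trans h3.1, fun k => (h3.2 k).trans (h2 k)⟩

/-- **Pruning is sound**: if every content with a nonzero value is dominated by `cap`, a state with a
label that is no longer dominated evaluates to `0` under every list of remaining columns.
[folklore] -/
private theorem evalColsK_eq_zero_of_not_domLE (S : List ℕ → R) (cap : List ℕ)
    (hS0 : ∀ c, S c ≠ 0 → domLE c cap = true) :
    ∀ (cs : List Column) (st : List (List ℕ)) (u : ℕ), u < st.length →
      domLE (st.getD u []) cap = false → evalColsK S cs st = 0
  | [], st, u, hu, h => by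
    rw [evalColsK]
    apply List.prod_eq_zero
    rw [List.mem_map]
    refine ⟨st.getD u [], ?_, ?_⟩
    · rw [List.getD_eq_getElem _ _ hu]; exact List.getElem_mem hu
    · by_contra hne
      have := hS0 _ hne
      rw [h] at this
      exact Bool.false_ne_true this
  | c :: cs, st, u, hu, h => by
    rw [evalColsK]
    apply List.sum_eq_zero
    intro x hx
    rw [List.mem_map] at hx
    obtain ⟨q, _, rfl⟩ := hx
    obtain ⟨h1, h2⟩ := getD_bumpAll_dominates st c.labels q.2 u
    rw [evalColsK_eq_zero_of_not_domLE S cap hS0 cs _ u (by rw [length_bumpAll]; exact hu)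
      (domLE_eq_false_mono _ _ cap h1 h2 h), mul_zero]

omit [CommRing R] in
/-- The checked increment: `some (incAt l i)` or `none`, and `none` only when the bumped entry exceeds
the bound. [folklore] -/
private theorem incChk_spec (bound : ℕ) : ∀ (l : List ℕ) (i : ℕ),
    incChk bound l i = some (incAt l i) ∨
      (incChk bound l i = none ∧ i < l.length ∧ bound < (incAt l i).getD i 0)
  | [], i => Or.inl rfl
  | a :: l, 0 => by
    simp only [incChk, incAt]
    by_cases h : a + 1 ≤ bound
    · left; simp [Nat.ble_eq, h]
    · right; simp [Nat.ble_eq, h]; omega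
  | a :: l, i + 1 => by
    simp only [incChk, incAt]
    rcases incChk_spec bound l i with h | ⟨h, hi, hb⟩
    · left; rw [h]
    · right; rw [h]; exact ⟨rfl, by simpa using hi, by simpa using hb⟩

omit [CommRing R] in
/-- The checked label bump: `some (bumpAt st u v)` or `none`, and `none` only when label `u` is no longer
dominated by `cap`. [folklore] -/
private theorem bumpChk_spec (cap : List ℕ) : ∀ (st : List (List ℕ)) (u v : ℕ),
    bumpChk cap st u v = some (bumpAt st u v) ∨
      (bumpChk cap st u v = none ∧ u < st.length ∧ domLE ((bumpAt st u v).getD u []) cap = false)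
  | [], u, v => Or.inl rfl
  | c :: st, 0, v => by
    simp only [bumpChk, bumpAt]
    rcases incChk_spec (cap.getD v 0) c v with h | ⟨h, hi, hb⟩
    · left; rw [h]
    · right; rw [h]
      refine ⟨rfl, by simp, ?_⟩
      simp only [List.getD_cons_zero]
      exact domLE_eq_false_of_lt _ _ v (by rw [length_incAt]; exact hi) hb
  | c :: st, u + 1, v => by
    simp only [bumpChk, bumpAt]
    rcases bumpChk_spec cap st u v with h | ⟨h, hu, hb⟩
    · left; rw [h]
    · right; rw [h]; exact ⟨rfl, by simpa using hu, by simpa using hb⟩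

omit [CommRing R] in
/-- **The checked bump**: `bumpAllChk cap st us vs` is `some (bumpAll st us vs)`, or it is `none` and some
label of the (unchecked) result is no longer dominated by `cap`. [folklore] -/
private theorem bumpAllChk_spec (cap : List ℕ) : ∀ (st : List (List ℕ)) (us vs : List ℕ),
    bumpAllChk cap st us vs = some (bumpAll st us vs) ∨
      (bumpAllChk cap st us vs = none ∧
        ∃ u, u < (bumpAll st us vs).length ∧ domLE ((bumpAll st us vs).getD u []) cap = false)
  | st, [], vs => by cases vs <;> exact Or.inl rfl
  | st, _ :: _, [] => Or.inl rfl
  | st, u :: us, v :: vs => by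
    rw [bumpAllChk, bumpAll]
    rcases bumpChk_spec cap st u v with h | ⟨h, hu, hb⟩
    · rw [h]; exact bumpAllChk_spec cap _ us vs
    · rw [h]
      right
      refine ⟨rfl, u, ?_, ?_⟩
      · rw [length_bumpAll, length_bumpAt]; exact hu
      · obtain ⟨h1, h2⟩ := getD_bumpAll_dominates (bumpAt st u v) us vs u
        exact domLE_eq_false_mono _ _ cap h1 h2 hb

end Prune

/-! ## §3 The programme preserves weighted sums of layers -/

section Program

variable {R : Type*} [CommRing R] [DecidableEq R]

/-- The weighted sum `∑ value · G(state)` of a layer. [folklore] -/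
def wsum (G : List (List ℕ) → R) (L : List (ℕ × List (List ℕ) × R)) : R :=
  (L.map fun e => e.2.2 * G e.2.1).sum

omit [DecidableEq R] in
/-- `wsum` of a cons. [folklore] -/
private theorem wsum_cons (G : List (List ℕ) → R) (a : ℕ × List (List ℕ) × R) (L : List (ℕ × List (List ℕ) × R)) :
    wsum G (a :: L) = a.2.2 * G a.2.1 + wsum G L := by
  simp [wsum]

omit [DecidableEq R] in
/-- `wsum` of the empty layer. [folklore] -/
private theorem wsum_nil (G : List (List ℕ) → R) : wsum G ([] : List (ℕ × List (List ℕ) × R)) = 0 := by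
  simp [wsum]

/-- The merge step preserves weighted sums. [folklore] -/
private theorem wsum_mergeMAux (G : List (List ℕ) → R) (a : ℕ × List (List ℕ) × R)
    (rest : List (ℕ × List (List ℕ) × R) → List (ℕ × List (List ℕ) × R)) (W : R)
    (hrest : ∀ l, wsum G (rest l) = W + wsum G l) :
    ∀ l₂ : List (ℕ × List (List ℕ) × R), wsum G (mergeMAux a rest l₂) = a.2.2 * G a.2.1 + W + wsum G l₂
  | [] => by rw [mergeMAux, wsum_cons, hrest, wsum_nil]; ring
  | b :: l₂ => by
    rw [mergeMAux]
    split_ifs with h1 h2 h3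
    · rw [wsum_cons, wsum_mergeMAux G a rest W hrest l₂, wsum_cons]; ring
    · simp only [Bool.and_eq_true, beq_iff_eq, decide_eq_true_eq] at h2
      rw [hrest, wsum_cons, ← h2.2]
      have : a.2.2 * G a.2.1 + b.2.2 * G a.2.1 = 0 := by rw [← add_mul, h3, zero_mul]
      linear_combination (-1 : R) * this
    · simp only [Bool.and_eq_true, beq_iff_eq, decide_eq_true_eq] at h2
      rw [hrest, wsum_cons, wsum_cons, ← h2.2]; ring
    · rw [wsum_cons, hrest, wsum_cons]; ring

/-- **`mergeM` preserves weighted sums.** [folklore] -/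
private theorem wsum_mergeM (G : List (List ℕ) → R) :
    ∀ l₁ l₂ : List (ℕ × List (List ℕ) × R), wsum G (mergeM l₁ l₂) = wsum G l₁ + wsum G l₂
  | [], l₂ => by rw [mergeM, wsum_nil, zero_add]
  | a :: l₁, l₂ => by
    rw [mergeM, wsum_mergeMAux G a (mergeM l₁) (wsum G l₁) (wsum_mergeM G l₁) l₂, wsum_cons]

/-- `mergePairs` preserves the total weighted sum. [folklore] -/
private theorem wsum_mergePairs (G : List (List ℕ) → R) :
    ∀ Ls : List (List (ℕ × List (List ℕ) × R)),
      ((mergePairs Ls).map (wsum G)).sum = (Ls.map (wsum G)).sum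
  | [] => rfl
  | [_] => rfl
  | a :: b :: Ls => by
    rw [mergePairs, List.map_cons, List.sum_cons, wsum_mergeM, wsum_mergePairs G Ls]
    simp [add_assoc]

/-- The sequential merge preserves the total weighted sum. [folklore] -/
private theorem wsum_foldr_mergeM (G : List (List ℕ) → R) :
    ∀ Ls : List (List (ℕ × List (List ℕ) × R)), wsum G (Ls.foldr mergeM []) = (Ls.map (wsum G)).sum
  | [] => by simp [wsum]
  | L :: Ls => by rw [List.foldr_cons, wsum_mergeM, wsum_foldr_mergeM G Ls, List.map_cons, List.sum_cons]

/-- **`mergeAll` preserves the total weighted sum.** [folklore] -/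
private theorem wsum_mergeAll (G : List (List ℕ) → R) :
    ∀ (n : ℕ) (Ls : List (List (ℕ × List (List ℕ) × R))), wsum G (mergeAll n Ls) = (Ls.map (wsum G)).sum
  | 0, Ls => by rw [mergeAll]; exact wsum_foldr_mergeM G Ls
  | n + 1, [] => by rw [mergeAll]; simp [wsum]
  | n + 1, [L] => by rw [mergeAll]; simp
  | n + 1, L :: L' :: Ls => by rw [mergeAll, wsum_mergeAll G n, wsum_mergePairs]

omit [DecidableEq R] in
/-- A signed value times `X` is the value times the signed `X`. [folklore] -/
private theorem ite_neg_mul (b : Bool) (v X : R) : (if b then -v else v) * X = v * (sgn b * X) := by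
  cases b <;> simp [sgn]

omit [DecidableEq R] in
/-- **The shifted copy along one column option carries the signed bumped weighted sum** (dropped states
evaluate to zero). [folklore] -/
private theorem wsum_shiftOpt (S : List ℕ → R) (cap : List ℕ) (hS0 : ∀ c, S c ≠ 0 → domLE c cap = true)
    (cs : List Column) (us : List ℕ) (o : Bool × List ℕ × ℕ) :
    ∀ L : List (ℕ × List (List ℕ) × R),
      wsum (evalColsK S cs) (shiftOpt cap us o L) =
        (L.map fun e => e.2.2 * (sgn o.1 * evalColsK S cs (bumpAll e.2.1 us o.2.1))).sum
  | [] => by simp [shiftOpt, wsum]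
  | e :: L => by
    have IH := wsum_shiftOpt S cap hS0 cs us o L
    simp only [shiftOpt, List.filterMap_cons] at IH ⊢
    rcases bumpAllChk_spec cap e.2.1 us o.2.1 with h | ⟨h, u, hu, hdom⟩
    · rw [h, List.map_cons, List.sum_cons, ← IH, wsum, List.map_cons, List.sum_cons, ite_neg_mul]
      rfl
    · rw [h, List.map_cons, List.sum_cons, ← IH,
        evalColsK_eq_zero_of_not_domLE S cap hS0 cs _ u hu hdom, mul_zero, mul_zero, zero_add]

omit [DecidableEq R] in
/-- Swapping a double sum over two lists. [folklore] -/
private theorem sum_map_comm {α β : Type*} (f : α → β → R) :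
    ∀ (l₁ : List α) (l₂ : List β),
      (l₁.map fun a => (l₂.map fun b => f a b).sum).sum = (l₂.map fun b => (l₁.map fun a => f a b).sum).sum
  | [], l₂ => by simp
  | a :: l₁, l₂ => by
    rw [List.map_cons, List.sum_cons, sum_map_comm f l₁ l₂, ← List.sum_map_add]
    rfl

/-- **One column step preserves the meaning of a layer**: the weighted sum against the remaining columns
`cs` of the stepped layer is the weighted sum against `c :: cs` of the layer. [folklore] -/
private theorem wsum_stepM (S : List ℕ → R) (cap : List ℕ) (hS0 : ∀ c, S c ≠ 0 → domLE c cap = true)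
    (V : ℕ) (c : Column) (cs : List Column) (L : List (ℕ × List (List ℕ) × R)) :
    wsum (evalColsK S cs) (stepM V cap c L) = wsum (evalColsK S (c :: cs)) L := by
  rw [stepM, wsum_mergeAll, List.map_map, colOpts, List.map_map]
  have h1 : ((permsSign c.vars).map ((wsum (evalColsK S cs) ∘ fun o => shiftOpt cap c.labels o L) ∘
      fun q => (q.1, q.2, keyDelta V c.labels q.2))) =
      (permsSign c.vars).map fun q =>
        (L.map fun e => e.2.2 * (sgn q.1 * evalColsK S cs (bumpAll e.2.1 c.labels q.2))).sum := by
    refine List.map_congr_left fun q _ => ?_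
    simp only [Function.comp]
    exact wsum_shiftOpt S cap hS0 cs c.labels _ L
  rw [h1, sum_map_comm]
  unfold wsum
  congr 1
  refine List.map_congr_left fun e _ => ?_
  rw [evalColsK, List.sum_map_mul_left]

/-- **All column steps preserve the meaning**: the final weighted sum of the layers of `cs` from `L` is
the weighted sum of `L` against `cs`. [folklore] -/
private theorem wsum_layersM (S : List ℕ → R) (cap : List ℕ) (hS0 : ∀ c, S c ≠ 0 → domLE c cap = true)
    (V : ℕ) : ∀ (cs : List Column) (L : List (ℕ × List (List ℕ) × R)),
      wsum (evalColsK S []) (layersM V cap cs L) = wsum (evalColsK S cs) L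
  | [], _ => rfl
  | c :: cs, L => by rw [layersM, wsum_layersM S cap hS0 V cs, wsum_stepM S cap hS0]

omit [DecidableEq R] in
/-- The final value of a layer is its weighted sum against no remaining column. [folklore] -/
private theorem finalM_eq_wsum (tab : List (List ℕ × R)) (L : List (ℕ × List (List ℕ) × R)) :
    finalM tab L = wsum (evalColsK (lookupC tab) []) L := by
  unfold finalM wsum
  rfl

omit [DecidableEq R] in
/-- Nonzero table values sit at keys of the table: if `lookupC tab c ≠ 0` then some entry `(c, value)`
of the table has that nonzero value. [folklore] -/
private theorem exists_mem_of_lookupC_ne_zero (tab : List (List ℕ × R)) (c : List ℕ) (h : lookupC tab c ≠ 0) :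
    ∃ e ∈ tab, e.1 = c ∧ e.2 ≠ 0 := by
  unfold lookupC at h
  cases hf : tab.find? (fun e => e.1 == c) with
  | none => rw [hf] at h; exact absurd rfl h
  | some e =>
    rw [hf] at h
    refine ⟨e, List.mem_of_find?_eq_some hf, ?_, h⟩
    have := List.find?_some hf
    exact beq_iff_eq.mp this

end Program

/-! ## §4 `evalM = evalC` -/

section Main

variable {R : Type*} [CommRing R] [DecidableEq R]

omit [DecidableEq R] in
/-- The empty words have zero content. [folklore] -/
private theorem map_counts_replicate_nil (V d : ℕ) :
    (List.replicate d ([] : List ℕ)).map (counts V) = List.replicate d (List.replicate V 0) := by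
  simp [counts, List.map_replicate]

/-- **The content-state column-major programme computes the column-major evaluator**: for a list point all
of whose terms have `m = Nw.perLabel` forms, a network passing its structural check, a content table
passing `checkTable` at `(V, m) = (Nw.varBound, Nw.perLabel)` and a bound `cap` dominating every key of
the table with a nonzero value, `evalM tab cap Nw = evalC P Nw`. No column-strictness is required.
[cite: DorflerIkenmeyerPanova2020, §5 eq. (5.6) and the dynamic programme over content vectors (arXiv p. 13)] -/
theorem evalM_eq_evalC (P : Point R) (Nw : Network) (tab : List (List ℕ × R)) (cap : List ℕ)
    (hP : ∀ t : Fin P.terms.length, (P.terms.get t).2.length = Nw.perLabel)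
    (hN : Nw.check = true)
    (htab : checkTable P Nw.varBound Nw.perLabel tab = true)
    (hcap : ∀ e ∈ tab, e.2 ≠ 0 → domLE e.1 cap = true) :
    evalM tab cap Nw = evalC P Nw := by
  obtain ⟨hlen, hlab, hcnt⟩ := Network.spec_of_check Nw hN
  have hV : 0 < Nw.varBound := Nat.succ_pos _
  have hS0 : ∀ c, lookupC tab c ≠ 0 → domLE c cap = true := by
    intro c hc
    obtain ⟨e, he, rfl, hne⟩ := exists_mem_of_lookupC_ne_zero tab c hc
    exact hcap e he hne
  have hS : ∀ w : List ℕ, w.length = Nw.perLabel → (∀ v ∈ w, v < Nw.varBound) →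
      symEntry P w = lookupC tab (counts Nw.varBound w) := fun w hw hv =>
    (lookupC_counts_eq_symEntry P hV tab htab hP w hw hv).symm
  rw [evalM, finalM_eq_wsum, wsum_layersM _ cap hS0, Network.initLayerM, wsum_cons, wsum_nil, add_zero,
    one_mul, evalC, ← map_counts_replicate_nil]
  symm
  refine evalCols_eq_evalColsK P Nw.varBound Nw.perLabel Nw.nlabels (lookupC tab) hS Nw.cols _
    (List.length_replicate ..) (fun w hw => ?_) (fun u hu => ?_) hlen
    (fun c hc v hv => lt_varBound Nw c hc v hv)
  · rw [List.eq_of_mem_replicate hw]; simp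
  · rw [List.getD_eq_getElem _ _ (by simpa using hu), List.getElem_replicate]
    simpa [Network.allLabels] using hcnt u hu

end Main

/-! ## §5 The certificate theorem for Chow points (content-state programme) -/

section Certificate

variable {N : ℕ} [NeZero N]

/-- `chowPoint` commutes with ring maps. [folklore] -/
private theorem chowPoint_map' {R S : Type*} [CommRing R] [CommRing S] (f : R →+* S) (rows : List (List R)) :
    (chowPoint rows).map f = chowPoint (rows.map fun ℓ => ℓ.map f) := by
  simp [chowPoint, Point.map]

/-- **One-entry certificate, content-state programme** (DIP Prop. 5.1's "`mult_μ(ℂ[Ch]) > 0`"): one network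
of shape `λ` with canonical alternators passing its structural check, one integer Chow point of `Ch_N^m`
with its checked content table, a bound `cap` dominating the table's nonzero keys, and a NONZERO value of
`evalM` give `0 < mult_{λ^*} K[Ch_N^m]`. Unlike the label-major twin
`coordRingMultiplicity_chowSet_pos_of_tableCertificate`, no column-strictness is asked.
[cite: DorflerIkenmeyerPanova2020, Prop. 5.1 and §5 (arXiv pp. 12–13)] -/
theorem coordRingMultiplicity_chowSet_pos_of_tableCertificateM (K : Type) [Field K] [CharZero K]
    {m e : ℕ} (hm : m ≠ 0) (lam : Nat.Partition e) (lamL : List ℕ)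
    (hlamL : lam.sortedParts = lamL) (hlen : lamL.length ≤ N)
    (Nw : Network) (rows : List (List ℤ)) (tab : List (List ℕ × ℤ)) (cap : List ℕ)
    (hnet : Nw.check = true ∧ Nw.canonicalVars = true ∧ Nw.perLabel = m ∧ Nw.shape = lamL)
    (hrows : rows.length = m) (htab : checkTable (chowPoint rows) Nw.varBound m tab = true)
    (hcap : (tab.all fun en => decide (en.2 = 0) || domLE en.1 cap) = true)
    (v : ℤ) (hval : evalM tab cap Nw = v) (hv : v ≠ 0) :
    0 < coordRingMultiplicity K (chowSet K N m) m
      (_root_.Literature.NumberTheory.DiophantineGeometry.Weight.dualOfPartition N lam) := by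
  obtain ⟨hchk, hcan, hpl, hsh⟩ := hnet
  classical
  let nets : Fin 1 → Network := fun _ => Nw
  let pts : Fin 1 → Point ℤ := fun _ => chowPoint rows
  have hpts : ∀ b, ∀ t ∈ (pts b).terms, t.2.length = m := by
    intro b t ht
    simp only [pts, chowPoint, List.mem_singleton] at ht
    subst ht; exact hrows
  have hZ : ∀ b, splfPoly (coefM ((pts b).map (Int.castRingHom K)))
      (formM (finRevEnum N) ((pts b).map (Int.castRingHom K)) m) ∈ chowSet K N m := by
    intro b
    rw [show (pts b).map (Int.castRingHom K) =
        chowPoint (rows.map fun ℓ => ℓ.map (Int.castRingHom K)) from chowPoint_map' _ _]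
    exact splfPoly_oneTerm_mem_chowSet (N := N) K m _ _ rfl
  have hcap' : ∀ en ∈ tab, en.2 ≠ 0 → domLE en.1 cap = true := by
    intro en hen hne
    have := (List.all_eq_true.mp hcap) en hen
    simp only [Bool.or_eq_true, decide_eq_true_eq] at this
    exact this.resolve_left hne
  have hev : evalC (chowPoint rows) Nw = v := by
    rw [← hval]
    refine (evalM_eq_evalC (chowPoint rows) Nw tab cap (fun t => ?_) hchk (hpl.symm ▸ htab) hcap').symm
    have : ((chowPoint rows).terms.get t) = (1, rows) := by
      have ht := t.isLt
      simp only [chowPoint, List.length_singleton, Nat.lt_one_iff] at ht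
      simp [chowPoint, List.get_eq_getElem]
    rw [this, hpl]; exact hrows
  have hdet : (Matrix.of fun a b => evalC (pts b) (nets a)).det ≠ 0 := by
    rw [Matrix.det_fin_one, Matrix.of_apply]
    show evalC (chowPoint rows) Nw ≠ 0
    rw [hev]; exact hv
  exact le_coordRingMultiplicity_of_certificate K hm lam lamL hlamL hlen nets
    (fun _ => hchk) (fun _ => hcan) (d := Nw.nlabels) (fun _ => rfl) (fun _ => hpl) (fun _ => hsh)
    pts hpts _ hZ hdet

end Certificate

end TableauEval

end Literature.Computability.AlgebraicComplexity
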